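import Mathlib
import HarnessLib
import Summits.SmoothPoincare4.SmoothPoincare4.Theses.SmoothBijectionDefect
import Literature.Topology.FourManifolds.CorkPresentationHomotopySphere
import Literature.Barriers.SmoothPoincare4.ExoticContractibleProofs

/-!
# Line `birth` — BC3 skeleton for the crux `ThinDefect` (stmt-SmoothPoincare4-13497)

Route `SmoothBijectionDefect` (route-SmoothPoincare4-SmoothBijectionDefect, crux rank 4), skeleton
registrar planner-skel-stmt-SmoothPoincare4-13497-0, 2026-08-17.

The crux (`Summit.SmoothPoincare4.SmoothPoincare4.Theses.SmoothBijectionDefect.ThinDefect`, (α) of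
the thesis): every homotopy 4-sphere `Σ` admits a SMOOTH BIJECTION `S⁴ → Σ` or `Σ → S⁴` (a `C^∞`
map for the `𝓡 4` structures which is bijective; its defect `{df singular}` may be non-empty).

## The line = the route's own Two-layer plan for `ThinDefect` (cork level), typed

`ThinDefect ⇐ CorkPresentation + CorkBijection + CorkTwistTransfer` (route header, TWO-LAYER PLAN:
"ThinDefect ⇐ CorkBijection → CorkTwistTransfer → ThinDefect, fed by the tree's
`HomotopySphere.exists_isCorkTwist_sphere_of_facts` (inputs Θ₄ = 0 and Matveyev1996, named facts)
and Freedman's extension of boundary diffeomorphisms over compact contractible pieces"). Three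
registered stubs, each a genuine piece stated over tree declarations:

* `stub_corkPresentation` (KNOWN modulo three named facts of the tree; size XL as formalisation
  debt, 0 as mathematics). Every homotopy 4-sphere `Σ` is a LOOSE-CORK TWIST of the round sphere
  with compact smooth exterior: `S⁴ = C ∪_φ W`, `Σ = C ∪_{φ ∘ τ} W` (`IsBoundaryGluing`) with `C`
  compact contractible, `W` compact, and the twist `τ : ∂C ≅ ∂C` extending to a
  self-HOMEOMORPHISM of `C` (`ExtendsToHomeomorph`). PROVED IN THIS FILE, sorry-free, from the
  named facts `isHCobordant_sphere_of_homotopySphere_four` (Θ₄ = 0, Kervaire–Milnor 1963, table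
  p. 504), `Matveyev1996_decomposition` (Matveyev 1996 / Curtis–Freedman–Hsiang–Stong 1996) and
  `Literature.Barriers.SmoothPoincare4.freedmanQuinn1990_homeomorph_extends_contractible`
  (Freedman–Quinn 1990, 11.1C/9.3C) — `corkPresentation_of_facts` below, via the tree's
  `HomotopySphere.exists_corkPresentation_of_facts` and `extendsToHomeomorph_of_freedmanQuinn`.
  So this stub is exactly fact-level: it closes the day those three leaves are `_holds`.
* `stub_corkBijection` (OPEN — the load-bearing stub; it is VERBATIM the route's rank-2 crux
  `CorkBijection`, item stmt-SmoothPoincare4-13495, so a proof of that item discharges it and a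
  refutation of that item kills this line, exactly as the route's KILL CRITERIA foresee). For a
  compact contractible smooth `C` and a boundary diffeomorphism `τ` extending to a homeomorphism,
  `τ` extends to a smooth bijection `g : C → C` which is the product `τ × id` on a collar of `∂C`.
* `stub_corkTwistTransfer` (folklore differential topology, size L in Lean: needs the gluing
  existence/uniqueness leaves `exists_isBoundaryGluing` / `nonempty_diffeomorph_of_isBoundaryGluing`
  of `Gluing.lean` with a PRESCRIBED collar on the `C`-side). If `X = C ∪_φ W` and
  `X' = C ∪_{φ ∘ τ} W` are boundary gluings of compact pieces into smooth 4-manifolds and `τ`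
  extends to a smooth bijection `g` of `C` that is `τ × id` on some collar `c` of `∂C`, then there
  is a smooth bijection `X' → X`. Proof in print: realise both gluings by the standard collar
  models `P_{φτ}`, `P_φ` built with the SAME collars `c` (of `∂C`) and `c_W` (of `∂W`) (Hirsch 1976,
  Thm. 8.2.1; uniqueness gives `X' ≅ P_{φτ}`, `P_φ ≅ X`); the map `g ∪ id : P_{φτ} → P_φ` is well
  defined (`g ∘ incl = incl ∘ τ` at collar height 0), bijective, smooth off the seam (`g` is `C^∞`
  on `int C`), and reads `(x, t) ↦ (τ x, t)` in the seam charts `c ∪ c_W` — smooth. NOT cork-specific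
  (no contractibility), NOT the crux (it produces nothing without a collared `g`), and stated as
  pure EXISTENCE of a smooth bijection (the naive `jC ∘ g ∘ jC'⁻¹ ∪ jW ∘ jW'⁻¹` for arbitrary gluing
  witnesses is only `C⁰` across the seam — normal jets of different witnesses need not match —
  which is why uniqueness of gluings is part of the stub's cost).

`ThinDefect_of : Sig.stub_corkPresentation → Sig.stub_corkBijection → Sig.stub_corkTwistTransfer →
ThinDefect` is the REAL composition (sorry-free): present `Σ` as `C ∪_{φτ} W` with `S⁴ = C ∪_φ W`
(stub 1), extend `τ` to a collared smooth bijection `g` of `C` (stub 2, its homeomorphism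
hypothesis supplied by stub 1), transfer (stub 3) to a smooth bijection `Σ → S⁴`, i.e. the second
disjunct of `ThinDefect`. `ThinDefect_proof : ThinDefect` is the skeleton in its final shape (it
depends on `sorryAx` only through the three `stub_*`).

## Disproof used / dead lines / negatives

`ledger crux ls stmt-SmoothPoincare4-13497`: no workfiles (no `Disproof.lean`, no earlier line) as
of 2026-08-17; `ledger negatives --problem SmoothPoincare4`: 0 refuted statements. Nothing to
honour or avoid yet. The route's refuter stamp (2026-08-15) records that `ThinDefect` is non-vacuous
(the round `S⁴` is a `HomotopySphere 4`) and resists `simp/aesop/exact?`.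

## BC3 audit (this seat; raw outputs in the seat's NOTES.md `birth-certificate:`)

`lean check --json` rc 0, `sorry` exactly in `stub_corkPresentation`, `stub_corkBijection`,
`stub_corkTwistTransfer` (sorry count 3 = stub count, zero elsewhere). Probes
`stub → ThinDefect` and `stub → SmoothPoincare4` by
`first | exact? | simpa | aesop` and by `first | exact? | simpa [stub, goal] | (unfold stub goal; simpa) | aesop`
FAIL for all three stubs (seat folder `bc/ThinDefect_stub_probes.lean`).
-/

set_option linter.dupNamespace false
set_option linter.unusedVariables false

noncomputable section

namespace Summit.SmoothPoincare4.SmoothPoincare4.Cruxes.ThinDefect.Birth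

open scoped Manifold ContDiff Topology
open Set Function
open Literature.Topology.FourManifolds
open Summit.SmoothPoincare4.SmoothPoincare4.Theses.SmoothBijectionDefect

/-- Local notation: the round 4-sphere `S⁴ ⊂ ℝ⁵` with Mathlib's manifold structure. -/
local notation "𝕊⁴" => (Metric.sphere (0 : EuclideanSpace ℝ (Fin 5)) 1)

/-! ### Stub signatures (`Sig.stub_*`; the registered stubs below restate them verbatim so that the
registered signatures are self-contained over tree declarations) -/

/-- STUB 1 SIGNATURE — LOOSE-CORK PRESENTATION OF HOMOTOPY 4-SPHERES. For every homotopy 4-sphere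
`Σ`: compact contractible smooth `C` (boundary datum `bC`), compact smooth exterior `W` (boundary
datum `bW`), `φ : ∂C ≅ ∂W`, `τ : ∂C ≅ ∂C` extending to a self-homeomorphism of `C`, with
`S⁴ = C ∪_φ W` and `Σ = C ∪_{φ ∘ τ} W`. Θ₄ = 0 + Matveyev + Freedman–Quinn
(`corkPresentation_of_facts`). -/
def Sig.stub_corkPresentation : Prop :=
  ∀ S : HomotopySphere 4, ∃ (C : Type) (_ : TopologicalSpace C) (_ : T2Space C)
      (_ : SecondCountableTopology C) (_ : ChartedSpace (EuclideanHalfSpace 4) C)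
      (_ : IsManifold (𝓡∂ 4) ∞ C) (_ : CompactSpace C) (_ : ContractibleSpace C)
      (bC : BoundaryData (𝓡∂ 4) C (𝓡 3))
      (W : Type) (_ : TopologicalSpace W) (_ : T2Space W) (_ : SecondCountableTopology W)
      (_ : ChartedSpace (EuclideanHalfSpace 4) W) (_ : IsManifold (𝓡∂ 4) ∞ W) (_ : CompactSpace W)
      (bW : BoundaryData (𝓡∂ 4) W (𝓡 3))
      (φ : bC.carrier ≃ₘ⟮𝓡 3, 𝓡 3⟯ bW.carrier) (τ : bC.carrier ≃ₘ⟮𝓡 3, 𝓡 3⟯ bC.carrier),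
      ExtendsToHomeomorph bC τ ∧
        IsBoundaryGluing bC bW φ (𝓡 4) 𝕊⁴ ∧ IsBoundaryGluing bC bW (τ.trans φ) (𝓡 4) S.carrier

/-- STUB 2 SIGNATURE — CORK SMOOTH EXTENSION = the route's crux `CorkBijection` verbatim
(item stmt-SmoothPoincare4-13495, rank 2). -/
def Sig.stub_corkBijection : Prop :=
  ∀ (C : Type) [TopologicalSpace C] [T2Space C] [SecondCountableTopology C]
    [ChartedSpace (EuclideanHalfSpace 4) C] [IsManifold (𝓡∂ 4) ∞ C] [CompactSpace C]
    [ContractibleSpace C] (b : BoundaryData (𝓡∂ 4) C (𝓡 3))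
    (τ : b.carrier ≃ₘ⟮𝓡 3, 𝓡 3⟯ b.carrier), ExtendsToHomeomorph b τ →
      ∃ g : C → C, ContMDiff (𝓡∂ 4) (𝓡∂ 4) ∞ g ∧ Function.Bijective g ∧
        ∃ c : b.Collar, ∀ (x : b.carrier) (t : Set.Icc (0 : ℝ) 1), g (c (x, t)) = c (τ x, t)

/-- STUB 3 SIGNATURE — CORK-TWIST TRANSFER OF COLLARED SMOOTH BIJECTIONS. If `X = C ∪_φ W` and
`X' = C ∪_{φ ∘ τ} W` (compact smooth pieces, smooth closed results) and `τ` extends to a smooth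
bijection `g` of `C` that is `τ × id` on a collar of `∂C`, then some smooth bijection `X' → X`
exists. -/
def Sig.stub_corkTwistTransfer : Prop :=
  ∀ (C : Type) [TopologicalSpace C] [T2Space C] [SecondCountableTopology C]
    [ChartedSpace (EuclideanHalfSpace 4) C] [IsManifold (𝓡∂ 4) ∞ C] [CompactSpace C]
    (bC : BoundaryData (𝓡∂ 4) C (𝓡 3))
    (W : Type) [TopologicalSpace W] [T2Space W] [SecondCountableTopology W]
    [ChartedSpace (EuclideanHalfSpace 4) W] [IsManifold (𝓡∂ 4) ∞ W] [CompactSpace W]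
    (bW : BoundaryData (𝓡∂ 4) W (𝓡 3))
    (φ : bC.carrier ≃ₘ⟮𝓡 3, 𝓡 3⟯ bW.carrier) (τ : bC.carrier ≃ₘ⟮𝓡 3, 𝓡 3⟯ bC.carrier)
    (g : C → C), ContMDiff (𝓡∂ 4) (𝓡∂ 4) ∞ g → Function.Bijective g →
    (∃ c : bC.Collar, ∀ (x : bC.carrier) (t : Set.Icc (0 : ℝ) 1), g (c (x, t)) = c (τ x, t)) →
    ∀ (X : Type) [TopologicalSpace X] [T2Space X] [SecondCountableTopology X]
      [ChartedSpace (EuclideanSpace ℝ (Fin 4)) X] [IsManifold (𝓡 4) ∞ X]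
      (X' : Type) [TopologicalSpace X'] [T2Space X'] [SecondCountableTopology X']
      [ChartedSpace (EuclideanSpace ℝ (Fin 4)) X'] [IsManifold (𝓡 4) ∞ X'],
      IsBoundaryGluing bC bW φ (𝓡 4) X → IsBoundaryGluing bC bW (τ.trans φ) (𝓡 4) X' →
        ∃ F : X' → X, ContMDiff (𝓡 4) (𝓡 4) ∞ F ∧ Function.Bijective F

/-! ### Registered stubs (the ONLY `sorry`s of the file) -/

/-- **Stub 1 — loose-cork presentation of homotopy 4-spheres** (known modulo the named facts
Θ₄ = 0, Matveyev 1996, Freedman–Quinn 11.1C; see `corkPresentation_of_facts`). Why plausibly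
true: it IS `corkPresentation_of_facts` applied to three published theorems. Size: XL as Lean
debt (the three leaves), nil as mathematics. Sources: KervaireMilnorAnnals1963 (table p. 504),
Matveyev1996 (Theorem, parts 1–2), CurtisFreedmanHsiangStong1996, FreedmanQuinn1990 (11.1C, 9.3C). -/
theorem stub_corkPresentation :
    ∀ S : HomotopySphere 4, ∃ (C : Type) (_ : TopologicalSpace C) (_ : T2Space C)
      (_ : SecondCountableTopology C) (_ : ChartedSpace (EuclideanHalfSpace 4) C)
      (_ : IsManifold (𝓡∂ 4) ∞ C) (_ : CompactSpace C) (_ : ContractibleSpace C)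
      (bC : BoundaryData (𝓡∂ 4) C (𝓡 3))
      (W : Type) (_ : TopologicalSpace W) (_ : T2Space W) (_ : SecondCountableTopology W)
      (_ : ChartedSpace (EuclideanHalfSpace 4) W) (_ : IsManifold (𝓡∂ 4) ∞ W) (_ : CompactSpace W)
      (bW : BoundaryData (𝓡∂ 4) W (𝓡 3))
      (φ : bC.carrier ≃ₘ⟮𝓡 3, 𝓡 3⟯ bW.carrier) (τ : bC.carrier ≃ₘ⟮𝓡 3, 𝓡 3⟯ bC.carrier),
      ExtendsToHomeomorph bC τ ∧
        IsBoundaryGluing bC bW φ (𝓡 4) (Metric.sphere (0 : EuclideanSpace ℝ (Fin 5)) 1) ∧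
          IsBoundaryGluing bC bW (τ.trans φ) (𝓡 4) S.carrier := by
  sorry

/-- **Stub 2 — cork smooth extension** (= the route crux `CorkBijection`, stmt-SmoothPoincare4-13495,
verbatim; OPEN, load-bearing, hardest). Why plausibly true: for the trivial twist it holds with
`g = id`; for a genuine cork the candidate is the twisted mapping cylinder over a `τ`-symmetric
special spine of `C`, squeezed flat in its two normal directions (route header, CHEAPEST FALSIFIER:
the Akbulut cork first). Why it might fail: a cork whose involution extends to NO smooth bijection
would be a new obstruction theorem. Sources: Akbulut1991Fake, AkbulutMatveyev1998, Matveyev1996,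
CurtisFreedmanHsiangStong1996, arXiv:math/0506577, FreedmanQuinn1990. -/
theorem stub_corkBijection :
    ∀ (C : Type) [TopologicalSpace C] [T2Space C] [SecondCountableTopology C]
      [ChartedSpace (EuclideanHalfSpace 4) C] [IsManifold (𝓡∂ 4) ∞ C] [CompactSpace C]
      [ContractibleSpace C] (b : BoundaryData (𝓡∂ 4) C (𝓡 3))
      (τ : b.carrier ≃ₘ⟮𝓡 3, 𝓡 3⟯ b.carrier), ExtendsToHomeomorph b τ →
        ∃ g : C → C, ContMDiff (𝓡∂ 4) (𝓡∂ 4) ∞ g ∧ Function.Bijective g ∧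
          ∃ c : b.Collar, ∀ (x : b.carrier) (t : Set.Icc (0 : ℝ) 1), g (c (x, t)) = c (τ x, t) := by
  sorry

/-- **Stub 3 — cork-twist transfer of collared smooth bijections** (folklore gluing lemma; size L
in Lean). Why plausibly true: in the standard collar models built with the collar on which `g` is a
product, `g ∪ id` reads `(x, t) ↦ (τ x, t)` across the seam; uniqueness of gluings moves it to the
given `X`, `X'`. Sources: HirschDT1976 (Thm. 8.2.1), BrockerJanich1982 (§13), MilnorHCobordism1965
(§1, Thm. 1.4); tree leaves `exists_isBoundaryGluing`, `nonempty_diffeomorph_of_isBoundaryGluing`,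
`BoundaryData.nonempty_collar`. -/
theorem stub_corkTwistTransfer :
    ∀ (C : Type) [TopologicalSpace C] [T2Space C] [SecondCountableTopology C]
      [ChartedSpace (EuclideanHalfSpace 4) C] [IsManifold (𝓡∂ 4) ∞ C] [CompactSpace C]
      (bC : BoundaryData (𝓡∂ 4) C (𝓡 3))
      (W : Type) [TopologicalSpace W] [T2Space W] [SecondCountableTopology W]
      [ChartedSpace (EuclideanHalfSpace 4) W] [IsManifold (𝓡∂ 4) ∞ W] [CompactSpace W]
      (bW : BoundaryData (𝓡∂ 4) W (𝓡 3))
      (φ : bC.carrier ≃ₘ⟮𝓡 3, 𝓡 3⟯ bW.carrier) (τ : bC.carrier ≃ₘ⟮𝓡 3, 𝓡 3⟯ bC.carrier)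
      (g : C → C), ContMDiff (𝓡∂ 4) (𝓡∂ 4) ∞ g → Function.Bijective g →
      (∃ c : bC.Collar, ∀ (x : bC.carrier) (t : Set.Icc (0 : ℝ) 1), g (c (x, t)) = c (τ x, t)) →
      ∀ (X : Type) [TopologicalSpace X] [T2Space X] [SecondCountableTopology X]
        [ChartedSpace (EuclideanSpace ℝ (Fin 4)) X] [IsManifold (𝓡 4) ∞ X]
        (X' : Type) [TopologicalSpace X'] [T2Space X'] [SecondCountableTopology X']
        [ChartedSpace (EuclideanSpace ℝ (Fin 4)) X'] [IsManifold (𝓡 4) ∞ X'],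
        IsBoundaryGluing bC bW φ (𝓡 4) X → IsBoundaryGluing bC bW (τ.trans φ) (𝓡 4) X' →
          ∃ F : X' → X, ContMDiff (𝓡 4) (𝓡 4) ∞ F ∧ Function.Bijective F := by
  sorry

/-! ### Sorry-free infrastructure: stub 1 is fact-level, stub 2 is the route item -/

/-- **Stub 1 from the tree's named facts** (sorry-free): Θ₄ = 0 (`isHCobordant_sphere_of_homotopySphere_four`),
Matveyev's two-piece decomposition (`Matveyev1996_decomposition`) and Freedman–Quinn 11.1C
(`freedmanQuinn1990_homeomorph_extends_contractible`) give the loose-cork presentation, through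
`HomotopySphere.exists_corkPresentation_of_facts` and `extendsToHomeomorph_of_freedmanQuinn`.
[cite: Matveyev1996, Theorem (parts 1–2)] [cite: KervaireMilnorAnnals1963, table p. 504]
[cite: FreedmanQuinn1990, Prop. 11.1C and Cor. 9.3C] -/
theorem corkPresentation_of_facts (hΘ : isHCobordant_sphere_of_homotopySphere_four)
    (hM : Matveyev1996_decomposition.{0})
    (hF : Literature.Barriers.SmoothPoincare4.freedmanQuinn1990_homeomorph_extends_contractible.{0}) :
    Sig.stub_corkPresentation := by
  intro S
  obtain ⟨C, _, _, _, _, _, hc, hk, bC, W, _, _, _, _, _, hcW, bW, φ, τ, h₁, h₂⟩ :=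
    HomotopySphere.exists_corkPresentation_of_facts hΘ hM S
  haveI : CompactSpace C := hc
  haveI : ContractibleSpace C := hk
  exact ⟨C, ‹_›, ‹_›, ‹_›, ‹_›, ‹_›, hc, hk, bC, W, ‹_›, ‹_›, ‹_›, ‹_›, ‹_›, hcW, bW, φ, τ,
    Literature.Barriers.SmoothPoincare4.extendsToHomeomorph_of_freedmanQuinn hF bC τ, h₁, h₂⟩

/-- Stub 2's signature is, up to unfolding, the route decl `CorkBijection` (so the route item
stmt-SmoothPoincare4-13495 and this stub close together). [bookkeeping] -/
theorem sig_stub_corkBijection_iff : Sig.stub_corkBijection ↔ CorkBijection := Iff.rfl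

/-! ### Composition: the three stubs prove the crux BY NAME -/

/-- **The line closes the crux modulo the three registered stubs** (sorry-free, pure logic over the
stub signatures): present `Σ = C ∪_{φτ} W`, `S⁴ = C ∪_φ W` with `τ` topologically extendable
(stub 1); extend `τ` to a collared smooth bijection `g` of `C` (stub 2); transfer to a smooth
bijection `Σ → S⁴` (stub 3) — the second disjunct of `ThinDefect`. [bookkeeping] -/
theorem ThinDefect_of :
    Sig.stub_corkPresentation → Sig.stub_corkBijection → Sig.stub_corkTwistTransfer →
      ThinDefect := by
  intro hP hCB hTr S
  obtain ⟨C, _, _, _, _, _, hc, hk, bC, W, _, _, _, _, _, hcW, bW, φ, τ, hext, h₁, h₂⟩ := hP S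
  haveI : CompactSpace C := hc
  haveI : ContractibleSpace C := hk
  haveI : CompactSpace W := hcW
  obtain ⟨g, hg, hbij, hcol⟩ := hCB C bC τ hext
  obtain ⟨F, hF, hFbij⟩ :=
    hTr C bC W bW φ τ g hg hbij hcol (Metric.sphere (0 : EuclideanSpace ℝ (Fin 5)) 1) S.carrier h₁ h₂
  exact Or.inr ⟨F, hF, hFbij⟩

/-- The skeleton in its final shape: the crux BY NAME from the three registered stubs (it becomes
the crux proof when the last `stub_*` is discharged; until then it depends on `sorryAx` through the
stubs only — no `sorry` of its own). [bookkeeping] -/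
theorem ThinDefect_proof : ThinDefect :=
  ThinDefect_of stub_corkPresentation stub_corkBijection stub_corkTwistTransfer

end Summit.SmoothPoincare4.SmoothPoincare4.Cruxes.ThinDefect.Birth

end
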